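import Summits.ResolutionOfSingularities.ResolutionOfSingularities.Theorems.LightCutMapA
import HarnessLib

/-!
# LightCutMapA2 — decomp-res node «LightCut» rev 2 §7 MAP (a) (lens-6 g22, critic row 171), §7 file 2/2

Content VERBATIM from the decomp-res lens-6 g22 node `HOME/decomp-res-lens-6/g22/LightCut.lean` rev 2 (pin eb3d2900,
1 426 l = rev 1 `61988fc1` + the pure
insertion §7 `section MapA`, l. 972–1423; farm rc 0 · 0 sorry · axioms std; HOME = run/shared/lean/pub/decomp-res).
Critic: CRITIC-LEDGER row 171 (2026-08-31T02:44:31Z):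
«LightCut» rev 2 CLEARED MAP +1 — MAP (a) of row 166 SETTLED NEGATIVELY: `E1TopHeavy` LEAKS BOTH WAYS (R3 = `z³ +
t²u² + t⁵ + u⁵ + w⁴` over `𝔽₃` is HEAVY with NO near
point; R2's near point is TAME).  Landing orders INBOX :731 (lens-6) / :734 (critic): §7 as a THIRD node file over
the untouched rev-1 files `LightCutLaw` · `LightCutLaw2` ·
`LightCutCells` (p803046 / p803238 / p803837; rev-1 declarations byte-identical in rev 2), namespace
`…Theorems.LightCutClasses`, `--supports
stmt-ResolutionOfSingularities-26971`; NO column edit (row 166's aside `LCE1TopHeavy` stands; `E1TopHeavy` is not a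
root-datum induction class; no new cell, no new aside).
WRITER'S CHOICE (row 171, option 2, stated on the bus): the PROOF-KIND part only — the §7a certificates,
`wildSuccessor_iff_pPowerFormAt`, `X_mul_mem_span_X_pow_iff`; the two
typed record sentences `def NearPointOfHeavyPrincipal : Prop` / `def WildSuccessorOfHeavyPrincipal : Prop`
(settled-NEGATIVE records, refuted by the R3 / R2 certificates here;
NOT cells, NOT asides, NOT wanted) are left OUT of the tree and live in the lens file.  File split only (tree files
≤ 400 lines): `section MapA`, its opens / variables,
`section chart_lemmas` and every declaration exactly as in the lens; the node's global dupNamespace-linter line dropped.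

## This file

§7a THE CERTIFICATES R3 / R2 (file 2/2 of §7, same `section MapA` replayed; the `private` chart lemmas `d_self` /
`d_ne` / `d_two` and all their users share this module): `d_self`, `d_ne`, `d_two`, `notNear_R3_chart_u`,
`notNear_R3_chart_t`, `notNear_R3_chart_w`, `notNear_R3_chart_z`, `heavy_R3`, `tame_successor_quartic`,
`R3_heavy_and_nearPointFree`.

[WRITER NOTE (decomp-res writer g10): split at the 400-line cap into `LightCutMapA` (+ continuation files); dedup
watch (row 171): `derivation_pow_succ_mem`,
`derivs_mem_of_mul_mem_cube`, `two_not_mem` are NEW statements (iterated / cube versions — not the landed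
`RadicialJung.CleanModels.derivation_apply_mem_of_mem_sq`, which
`LightCutCells` already cites by name); the chart lemmas `d_self` / `d_ne` / `d_two` are `private` as in the lens.]

(Sources: Hironaka 1967 (characteristic polyhedra); CossartJannsenSaito2020 Thm. 9.6 (2) p. 136, Def. 3.13 / Thm.
3.14 p. 129; CossartPiltant2008 §2; Giraud1975; Hironaka1970Additive; Moh1987.)
-/

noncomputable section

open CategoryTheory AlgebraicGeometry TopologicalSpace IsLocalRing
open Literature.AlgebraicGeometry.Resolution

universe u

namespace Summit.ResolutionOfSingularities.ResolutionOfSingularities.Theorems.LightCutClasses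

open Summit.ResolutionOfSingularities.ResolutionOfSingularities.Theorems.TwistCutClasses

section MapA

open MvPolynomial
open Summit.ResolutionOfSingularities.ResolutionOfSingularities.Theorems
open WeakOrderReduction ForcedTowerClasses SubfieldContactClasses AbsoluteContactClasses PurityValveClasses TwistCutClasses
variable {K : Type*} [Field K]

section chart_lemmas

variable (K)
-- the sixteen `∂_i X_j` facts on `Fin 4`, instantiated once

/-- `d_self`: Auxiliary step of this node's calculus, VERBATIM from the lens file (see the module docstring); the
statement is its type. [folklore] -/
private theorem d_self (i : Fin 4) : pderiv i (X i : MvPolynomial (Fin 4) K) = 1 := by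
  classical
  exact pderiv_X_self i

/-- `d_ne`: Auxiliary step of this node's calculus, VERBATIM from the lens file (see the module docstring); the
statement is its type. [folklore] -/
private theorem d_ne {i j : Fin 4} (h : j ≠ i) : pderiv i (X j : MvPolynomial (Fin 4) K) = 0 := by
  classical
  exact pderiv_X_of_ne h

/-- `d_two`: Auxiliary step of this node's calculus, VERBATIM from the lens file (see the module docstring); the
statement is its type. [folklore] -/
private theorem d_two (i : Fin 4) : pderiv i (2 : MvPolynomial (Fin 4) K) = 0 := by
  have := (pderiv i : Derivation K (MvPolynomial (Fin 4) K) _).map_natCast 2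
  exact_mod_cast this

end chart_lemmas

/-- **R3, chart `u`**: the controlled transform `f'ᵤ = z'³ + u(t'² + w'⁴) + u²(1 + t'⁵)` of `f = z³ + t²u² + t⁵ + u⁵ + w⁴`
(variables `0 = z', 1 = t', 2 = u, 3 = w'`) has order `≤ 2 < 3` at EVERY prime containing the exceptional parameter `u`
(chart `t` is the same computation with `t ↔ u`): no near point in these charts.
(`∂_u∂_u f' = 2(1 + t'⁵)`, `∂_{t'}∂_u f' = 2t' + 10 u t'⁴`.)  [new; elementary] [folklore] -/
theorem notNear_R3_chart_u [CharP K 3] (𝔫 : Ideal (MvPolynomial (Fin 4) K)) [𝔫.IsPrime]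
    (hu : (X 2 : MvPolynomial (Fin 4) K) ∈ 𝔫) {s : MvPolynomial (Fin 4) K} (hs : s ∉ 𝔫) :
    s * (X 0 ^ 3 + X 2 * (X 1 ^ 2 + X 3 ^ 4) + X 2 ^ 2 * (1 + X 1 ^ 5)) ∉ 𝔫 ^ 3 := by
  classical
  intro hmem
  have d20 := d_ne K (i := 2) (j := 0) (by decide)
  have d21 := d_ne K (i := 2) (j := 1) (by decide)
  have d23 := d_ne K (i := 2) (j := 3) (by decide)
  have d22 := d_self K 2
  have d10 := d_ne K (i := 1) (j := 0) (by decide)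
  have d12 := d_ne K (i := 1) (j := 2) (by decide)
  have d13 := d_ne K (i := 1) (j := 3) (by decide)
  have d11 := d_self K 1
  have hu1 : (pderiv 2) (X 0 ^ 3 + X 2 * (X 1 ^ 2 + X 3 ^ 4) + X 2 ^ 2 * (1 + X 1 ^ 5) : MvPolynomial (Fin 4) K)
      = X 1 ^ 2 + X 3 ^ 4 + 2 * X 2 * (1 + X 1 ^ 5) := by
    simp only [map_add, Derivation.leibniz, Derivation.leibniz_pow, Derivation.map_one_eq_zero, smul_eq_mul,
      nsmul_eq_mul, d20, d21, d22, d23]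
    push_cast
    ring
  have huu : (pderiv 2) ((pderiv 2) (X 0 ^ 3 + X 2 * (X 1 ^ 2 + X 3 ^ 4) + X 2 ^ 2 * (1 + X 1 ^ 5)
      : MvPolynomial (Fin 4) K)) = 2 * (1 + X 1 ^ 5) := by
    rw [hu1]
    simp only [map_add, Derivation.leibniz, Derivation.leibniz_pow, Derivation.map_one_eq_zero, smul_eq_mul,
      nsmul_eq_mul, d21, d22, d23, d_two]
    push_cast
    ring
  have htu : (pderiv 1) ((pderiv 2) (X 0 ^ 3 + X 2 * (X 1 ^ 2 + X 3 ^ 4) + X 2 ^ 2 * (1 + X 1 ^ 5)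
      : MvPolynomial (Fin 4) K)) = 2 * X 1 + 10 * X 2 * X 1 ^ 4 := by
    rw [hu1]
    simp only [map_add, Derivation.leibniz, Derivation.leibniz_pow, Derivation.map_one_eq_zero, smul_eq_mul,
      nsmul_eq_mul, d11, d12, d13, d_two]
    push_cast
    ring
  obtain ⟨-, -, h1⟩ := derivs_mem_of_mul_mem_cube 𝔫 hs hmem (pderiv 2) (pderiv 2)
  obtain ⟨-, -, h2⟩ := derivs_mem_of_mul_mem_cube 𝔫 hs hmem (pderiv 1) (pderiv 2)
  rw [huu] at h1
  rw [htu] at h2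
  have h2ne := two_not_mem (K := K) 𝔫
  -- from h2: `2 t' + 10 u t'^4 ∈ 𝔫`, `u ∈ 𝔫` ⇒ `t' ∈ 𝔫`
  have ht : (X 1 : MvPolynomial (Fin 4) K) ∈ 𝔫 := by
    have : 2 * (X 1 : MvPolynomial (Fin 4) K) ∈ 𝔫 := by
      have := Ideal.sub_mem _ h2 (Ideal.mul_mem_right (X 1 ^ 4) _ (Ideal.mul_mem_left _ 10 hu))
      rwa [show 2 * X 1 + 10 * X 2 * X 1 ^ 4 - 10 * X 2 * X 1 ^ 4 = (2 * X 1 : MvPolynomial (Fin 4) K) by ring] at this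
    exact ((‹𝔫.IsPrime›.mem_or_mem this).resolve_left h2ne)
  -- from h1: `2 (1 + t'^5) ∈ 𝔫` ⇒ `1 + t'^5 ∈ 𝔫` ⇒ `1 ∈ 𝔫`
  have h15 : (1 + X 1 ^ 5 : MvPolynomial (Fin 4) K) ∈ 𝔫 := (‹𝔫.IsPrime›.mem_or_mem h1).resolve_left h2ne
  have h1mem : (1 : MvPolynomial (Fin 4) K) ∈ 𝔫 := by
    have := Ideal.sub_mem _ h15 (Ideal.pow_mem_of_mem 𝔫 ht 5 (by norm_num))
    rwa [add_sub_cancel_right] at this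
  exact ‹𝔫.IsPrime›.ne_top ((Ideal.eq_top_iff_one _).2 h1mem)

/-- **R3, chart `t`**: the controlled transform `f'_t = z'³ + t(u'² + w'⁴) + t²(1 + u'⁵)` (variables `0 = z', 1 = t,
2 = u', 3 = w'`; it is `f'ᵤ` with `t ↔ u`, `f` being symmetric in `t, u`) has order `≤ 2 < 3` at every prime containing `t`.
[new; elementary] [folklore] -/
theorem notNear_R3_chart_t [CharP K 3] (𝔫 : Ideal (MvPolynomial (Fin 4) K)) [𝔫.IsPrime]
    (ht₀ : (X 1 : MvPolynomial (Fin 4) K) ∈ 𝔫) {s : MvPolynomial (Fin 4) K} (hs : s ∉ 𝔫) :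
    s * (X 0 ^ 3 + X 1 * (X 2 ^ 2 + X 3 ^ 4) + X 1 ^ 2 * (1 + X 2 ^ 5)) ∉ 𝔫 ^ 3 := by
  classical
  intro hmem
  have d20 := d_ne K (i := 1) (j := 0) (by decide)
  have d21 := d_ne K (i := 1) (j := 2) (by decide)
  have d23 := d_ne K (i := 1) (j := 3) (by decide)
  have d22 := d_self K 1
  have d10 := d_ne K (i := 2) (j := 0) (by decide)
  have d12 := d_ne K (i := 2) (j := 1) (by decide)
  have d13 := d_ne K (i := 2) (j := 3) (by decide)
  have d11 := d_self K 2
  have hu1 : (pderiv 1) (X 0 ^ 3 + X 1 * (X 2 ^ 2 + X 3 ^ 4) + X 1 ^ 2 * (1 + X 2 ^ 5) : MvPolynomial (Fin 4) K)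
      = X 2 ^ 2 + X 3 ^ 4 + 2 * X 1 * (1 + X 2 ^ 5) := by
    simp only [map_add, Derivation.leibniz, Derivation.leibniz_pow, Derivation.map_one_eq_zero, smul_eq_mul,
      nsmul_eq_mul, d20, d21, d22, d23]
    push_cast
    ring
  have huu : (pderiv 1) ((pderiv 1) (X 0 ^ 3 + X 1 * (X 2 ^ 2 + X 3 ^ 4) + X 1 ^ 2 * (1 + X 2 ^ 5)
      : MvPolynomial (Fin 4) K)) = 2 * (1 + X 2 ^ 5) := by
    rw [hu1]
    simp only [map_add, Derivation.leibniz, Derivation.leibniz_pow, Derivation.map_one_eq_zero, smul_eq_mul,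
      nsmul_eq_mul, d21, d22, d23, d_two]
    push_cast
    ring
  have htu : (pderiv 2) ((pderiv 1) (X 0 ^ 3 + X 1 * (X 2 ^ 2 + X 3 ^ 4) + X 1 ^ 2 * (1 + X 2 ^ 5)
      : MvPolynomial (Fin 4) K)) = 2 * X 2 + 10 * X 1 * X 2 ^ 4 := by
    rw [hu1]
    simp only [map_add, Derivation.leibniz, Derivation.leibniz_pow, Derivation.map_one_eq_zero, smul_eq_mul,
      nsmul_eq_mul, d11, d12, d13, d_two]
    push_cast
    ring
  obtain ⟨-, -, h1⟩ := derivs_mem_of_mul_mem_cube 𝔫 hs hmem (pderiv 1) (pderiv 1)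
  obtain ⟨-, -, h2⟩ := derivs_mem_of_mul_mem_cube 𝔫 hs hmem (pderiv 2) (pderiv 1)
  rw [huu] at h1
  rw [htu] at h2
  have h2ne := two_not_mem (K := K) 𝔫
  -- from h2: `2 t' + 10 u t'^4 ∈ 𝔫`, `u ∈ 𝔫` ⇒ `t' ∈ 𝔫`
  have ht : (X 2 : MvPolynomial (Fin 4) K) ∈ 𝔫 := by
    have : 2 * (X 2 : MvPolynomial (Fin 4) K) ∈ 𝔫 := by
      have := Ideal.sub_mem _ h2 (Ideal.mul_mem_right (X 2 ^ 4) _ (Ideal.mul_mem_left _ 10 ht₀))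
      rwa [show 2 * X 2 + 10 * X 1 * X 2 ^ 4 - 10 * X 1 * X 2 ^ 4 = (2 * X 2 : MvPolynomial (Fin 4) K) by ring] at this
    exact ((‹𝔫.IsPrime›.mem_or_mem this).resolve_left h2ne)
  -- from h1: `2 (1 + t'^5) ∈ 𝔫` ⇒ `1 + t'^5 ∈ 𝔫` ⇒ `1 ∈ 𝔫`
  have h15 : (1 + X 2 ^ 5 : MvPolynomial (Fin 4) K) ∈ 𝔫 := (‹𝔫.IsPrime›.mem_or_mem h1).resolve_left h2ne
  have h1mem : (1 : MvPolynomial (Fin 4) K) ∈ 𝔫 := by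
    have := Ideal.sub_mem _ h15 (Ideal.pow_mem_of_mem 𝔫 ht 5 (by norm_num))
    rwa [add_sub_cancel_right] at this
  exact ‹𝔫.IsPrime›.ne_top ((Ideal.eq_top_iff_one _).2 h1mem)

/-- **R3, chart `w`**: the controlled transform `f'_w = z'³ + w(1 + t'²u'²) + w²(t'⁵ + u'⁵)` (variables `0 = z', 1 = t',
2 = u', 3 = w`) has order `≤ 2 < 3` at every prime containing `w`.  (`∂_w f' ≡ 1 + t'²u'² (mod w)`,
`∂_{t'}∂_w f' = 2t'u'² + 10wt'⁴`.)  [new; elementary] [folklore] -/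
theorem notNear_R3_chart_w [CharP K 3] (𝔫 : Ideal (MvPolynomial (Fin 4) K)) [𝔫.IsPrime]
    (hw : (X 3 : MvPolynomial (Fin 4) K) ∈ 𝔫) {s : MvPolynomial (Fin 4) K} (hs : s ∉ 𝔫) :
    s * (X 0 ^ 3 + X 3 * (1 + X 1 ^ 2 * X 2 ^ 2) + X 3 ^ 2 * (X 1 ^ 5 + X 2 ^ 5)) ∉ 𝔫 ^ 3 := by
  classical
  intro hmem
  have d30 := d_ne K (i := 3) (j := 0) (by decide)
  have d31 := d_ne K (i := 3) (j := 1) (by decide)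
  have d32 := d_ne K (i := 3) (j := 2) (by decide)
  have d33 := d_self K 3
  have d10 := d_ne K (i := 1) (j := 0) (by decide)
  have d12 := d_ne K (i := 1) (j := 2) (by decide)
  have d13 := d_ne K (i := 1) (j := 3) (by decide)
  have d11 := d_self K 1
  have hw1 : (pderiv 3) (X 0 ^ 3 + X 3 * (1 + X 1 ^ 2 * X 2 ^ 2) + X 3 ^ 2 * (X 1 ^ 5 + X 2 ^ 5) : MvPolynomial (Fin 4) K)
      = 1 + X 1 ^ 2 * X 2 ^ 2 + 2 * X 3 * (X 1 ^ 5 + X 2 ^ 5) := by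
    simp only [map_add, Derivation.leibniz, Derivation.leibniz_pow, Derivation.map_one_eq_zero, smul_eq_mul,
      nsmul_eq_mul, d30, d31, d32, d33]
    push_cast
    ring
  have htw : (pderiv 1) ((pderiv 3) (X 0 ^ 3 + X 3 * (1 + X 1 ^ 2 * X 2 ^ 2) + X 3 ^ 2 * (X 1 ^ 5 + X 2 ^ 5)
      : MvPolynomial (Fin 4) K)) = 2 * X 1 * X 2 ^ 2 + 10 * X 3 * X 1 ^ 4 := by
    rw [hw1]
    simp only [map_add, Derivation.leibniz, Derivation.leibniz_pow, Derivation.map_one_eq_zero, smul_eq_mul,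
      nsmul_eq_mul, d11, d12, d13, d_two]
    push_cast
    ring
  obtain ⟨-, h1, -⟩ := derivs_mem_of_mul_mem_cube 𝔫 hs hmem (pderiv 3) (pderiv 3)
  obtain ⟨-, -, h2⟩ := derivs_mem_of_mul_mem_cube 𝔫 hs hmem (pderiv 1) (pderiv 3)
  rw [hw1] at h1
  rw [htw] at h2
  have h2ne := two_not_mem (K := K) 𝔫
  -- from h2 and `w ∈ 𝔫`: `2 t' u'^2 ∈ 𝔫` ⇒ `t' u' ∈ 𝔫`-ish ⇒ `t'^2 u'^2 ∈ 𝔫`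
  have htu2 : (X 1 ^ 2 * X 2 ^ 2 : MvPolynomial (Fin 4) K) ∈ 𝔫 := by
    have : 2 * X 1 * X 2 ^ 2 ∈ 𝔫 := by
      have := Ideal.sub_mem _ h2 (Ideal.mul_mem_right (X 1 ^ 4) _ (Ideal.mul_mem_left _ 10 hw))
      rwa [show 2 * X 1 * X 2 ^ 2 + 10 * X 3 * X 1 ^ 4 - 10 * X 3 * X 1 ^ 4 = (2 * X 1 * X 2 ^ 2 : MvPolynomial (Fin 4) K)
        by ring] at this
    have h' : X 1 * X 2 ^ 2 ∈ 𝔫 := by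
      rw [mul_assoc] at this
      exact (‹𝔫.IsPrime›.mem_or_mem this).resolve_left h2ne
    have := Ideal.mul_mem_left _ (X 1) h'
    rwa [show X 1 * (X 1 * X 2 ^ 2) = (X 1 ^ 2 * X 2 ^ 2 : MvPolynomial (Fin 4) K) by ring] at this
  -- from h1 and `w ∈ 𝔫`: `1 + t'^2 u'^2 ∈ 𝔫` ⇒ `1 ∈ 𝔫`
  have h1mem : (1 : MvPolynomial (Fin 4) K) ∈ 𝔫 := by
    have h' : (1 + X 1 ^ 2 * X 2 ^ 2 : MvPolynomial (Fin 4) K) ∈ 𝔫 := by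
      have := Ideal.sub_mem _ h1 (Ideal.mul_mem_right (X 1 ^ 5 + X 2 ^ 5) _ (Ideal.mul_mem_left _ 2 hw))
      rwa [show 1 + X 1 ^ 2 * X 2 ^ 2 + 2 * X 3 * (X 1 ^ 5 + X 2 ^ 5) - 2 * X 3 * (X 1 ^ 5 + X 2 ^ 5)
        = (1 + X 1 ^ 2 * X 2 ^ 2 : MvPolynomial (Fin 4) K) by ring] at this
    have := Ideal.sub_mem _ h' htu2
    rwa [add_sub_cancel_right] at this
  exact ‹𝔫.IsPrime›.ne_top ((Ideal.eq_top_iff_one _).2 h1mem)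

/-- **R3, chart `z`**: the controlled transform `f'_z = 1 + z(t'²u'² + w'⁴) + z²(t'⁵ + u'⁵)` (variables `0 = z, 1 = t',
2 = u', 3 = w'`) is a unit at every prime containing `z`: no point of the transform lies in this chart over `y`.
[new; elementary] [folklore] -/
theorem notNear_R3_chart_z (𝔫 : Ideal (MvPolynomial (Fin 4) K)) [𝔫.IsPrime]
    (hz : (X 0 : MvPolynomial (Fin 4) K) ∈ 𝔫) {s : MvPolynomial (Fin 4) K} (hs : s ∉ 𝔫) :
    s * (1 + X 0 * (X 1 ^ 2 * X 2 ^ 2 + X 3 ^ 4) + X 0 ^ 2 * (X 1 ^ 5 + X 2 ^ 5)) ∉ 𝔫 ^ 3 := by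
  intro hmem
  have h1 : s * (1 + X 0 * (X 1 ^ 2 * X 2 ^ 2 + X 3 ^ 4) + X 0 ^ 2 * (X 1 ^ 5 + X 2 ^ 5)) ∈ 𝔫 :=
    Ideal.pow_le_self (by norm_num) hmem
  have hg : (1 + X 0 * (X 1 ^ 2 * X 2 ^ 2 + X 3 ^ 4) + X 0 ^ 2 * (X 1 ^ 5 + X 2 ^ 5) : MvPolynomial (Fin 4) K) ∈ 𝔫 :=
    (‹𝔫.IsPrime›.mem_or_mem h1).resolve_left hs
  have : (1 : MvPolynomial (Fin 4) K) ∈ 𝔫 := by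
    have := Ideal.sub_mem _ hg (Ideal.add_mem _ (Ideal.mul_mem_right (X 1 ^ 2 * X 2 ^ 2 + X 3 ^ 4) _ hz)
      (Ideal.mul_mem_right (X 1 ^ 5 + X 2 ^ 5) _ (Ideal.pow_mem_of_mem 𝔫 hz 2 (by norm_num))))
    rwa [show (1 + X 0 * (X 1 ^ 2 * X 2 ^ 2 + X 3 ^ 4) + X 0 ^ 2 * (X 1 ^ 5 + X 2 ^ 5)
      - (X 0 * (X 1 ^ 2 * X 2 ^ 2 + X 3 ^ 4) + X 0 ^ 2 * (X 1 ^ 5 + X 2 ^ 5)) : MvPolynomial (Fin 4) K) = 1 by ring] at this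
  exact ‹𝔫.IsPrime›.ne_top ((Ideal.eq_top_iff_one _).2 this)

/-- **R3 is HEAVY** (chart `u`: reduced layer `Ḡ₁ = T'² + W'⁴` from the layer `t²u² + w⁴`; variables `0 = Z̄, 1 = T',
2 = W'` of `κ[Z̄, T', W']`): at the prime `𝔮 = (Z̄, T', W') ∋ Z̄`, `1 · Ḡ₁ ∈ 𝔮^{3-1}` with `1 ∉ 𝔮` — the light
condition FAILS in this presentation (and in every one, the multiplicity-2 points `[1:0:0]`, `[0:1:0]` of the quartic
`T²U² + W⁴` on `ℙ(Dir_y)` being intrinsic).  [new; elementary] [folklore] -/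
theorem heavy_R3 :
    (X 1 ^ 2 + X 2 ^ 4 : MvPolynomial (Fin 3) K) ∈ (Ideal.span {(X 0 : MvPolynomial (Fin 3) K), X 1, X 2}) ^ (3 - 1) := by
  have h1 : (X 1 : MvPolynomial (Fin 3) K) ∈ Ideal.span {(X 0 : MvPolynomial (Fin 3) K), X 1, X 2} :=
    Ideal.subset_span (by simp)
  have h2 : (X 2 : MvPolynomial (Fin 3) K) ∈ Ideal.span {(X 0 : MvPolynomial (Fin 3) K), X 1, X 2} :=
    Ideal.subset_span (by simp)
  refine Ideal.add_mem _ (Ideal.pow_mem_pow h1 2) ?_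
  have : (X 2 ^ 4 : MvPolynomial (Fin 3) K) = X 2 ^ 2 * X 2 ^ 2 := by ring
  rw [this]
  exact Ideal.mul_mem_right _ _ (Ideal.pow_mem_pow h2 2)

/-- **The quartic inhabitant's near point is TAME** (R2 = `z³ + t⁴ + u²w²`, chart `u`: `f' = z'³ + u(w'² + t'⁴)`,
variables `0 = z', 1 = t', 2 = u, 3 = w'`): `∂_{w'}∂_{w'} f' = 2u`, so the Hasse derivative `D^{(2)}_{w'} f' = u` is a
regular parameter at the near point `𝔫 = (z', t', u, w')` extracted by an absolute differential operator of order
`2 = n - 1`: the successor point is an absolute maximal-contact (tame) point — it LEAVES the class `E1TopHeavy`.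
[new; elementary] [folklore] -/
theorem tame_successor_quartic :
    (pderiv 3) ((pderiv 3) (X 0 ^ 3 + X 2 * (X 3 ^ 2 + X 1 ^ 4) : MvPolynomial (Fin 4) K)) = 2 * X 2 := by
  classical
  have d30 := d_ne K (i := 3) (j := 0) (by decide)
  have d31 := d_ne K (i := 3) (j := 1) (by decide)
  have d32 := d_ne K (i := 3) (j := 2) (by decide)
  have d33 := d_self K 3
  have h1 : (pderiv 3) (X 0 ^ 3 + X 2 * (X 3 ^ 2 + X 1 ^ 4) : MvPolynomial (Fin 4) K) = 2 * X 2 * X 3 := by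
    simp only [map_add, Derivation.leibniz, Derivation.leibniz_pow, smul_eq_mul, nsmul_eq_mul, d30, d31, d32, d33]
    push_cast
    ring
  rw [h1]
  simp only [Derivation.leibniz, smul_eq_mul, d32, d33, d_two]
  ring

/-- **ONE KERNEL STATEMENT — R3 LEAKS OUT OF `E1TopHeavy` DOWNWARDS**: over EVERY field `K` of characteristic `3`,
the second-face
datum of R3 = `z³ + t²u² + t⁵ + u⁵ + w⁴` is HEAVY (chart `u`: `T'² + W'⁴ ∈ (Z̄, T', W')^{3-1}`) AND in each of the
FOUR Rees charts of
the blow-up of the origin the controlled transform `f'ᵢ` satisfies `s · f'ᵢ ∉ 𝔫³` for every prime `𝔫 ∋ cᵢ` and every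
`s ∉ 𝔫` — no point
over the origin, rational or not, has order `3`: the typed sentence `NearPointOfHeavyPrincipal` (every heavy
principal wild non-split
closed top point has a near point) FAILS at R3.  [new; elementary] [folklore] -/
theorem R3_heavy_and_nearPointFree [CharP K 3] :
    ((X 1 ^ 2 + X 2 ^ 4 : MvPolynomial (Fin 3) K) ∈ (Ideal.span {(X 0 : MvPolynomial (Fin 3) K), X 1, X 2}) ^ (3 - 1)) ∧
    (∀ (𝔫 : Ideal (MvPolynomial (Fin 4) K)), 𝔫.IsPrime → (X 2 : MvPolynomial (Fin 4) K) ∈ 𝔫 → ∀ s ∉ 𝔫,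
      s * (X 0 ^ 3 + X 2 * (X 1 ^ 2 + X 3 ^ 4) + X 2 ^ 2 * (1 + X 1 ^ 5)) ∉ 𝔫 ^ 3) ∧
    (∀ (𝔫 : Ideal (MvPolynomial (Fin 4) K)), 𝔫.IsPrime → (X 1 : MvPolynomial (Fin 4) K) ∈ 𝔫 → ∀ s ∉ 𝔫,
      s * (X 0 ^ 3 + X 1 * (X 2 ^ 2 + X 3 ^ 4) + X 1 ^ 2 * (1 + X 2 ^ 5)) ∉ 𝔫 ^ 3) ∧
    (∀ (𝔫 : Ideal (MvPolynomial (Fin 4) K)), 𝔫.IsPrime → (X 3 : MvPolynomial (Fin 4) K) ∈ 𝔫 → ∀ s ∉ 𝔫,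
      s * (X 0 ^ 3 + X 3 * (1 + X 1 ^ 2 * X 2 ^ 2) + X 3 ^ 2 * (X 1 ^ 5 + X 2 ^ 5)) ∉ 𝔫 ^ 3) ∧
    (∀ (𝔫 : Ideal (MvPolynomial (Fin 4) K)), 𝔫.IsPrime → (X 0 : MvPolynomial (Fin 4) K) ∈ 𝔫 → ∀ s ∉ 𝔫,
      s * (1 + X 0 * (X 1 ^ 2 * X 2 ^ 2 + X 3 ^ 4) + X 0 ^ 2 * (X 1 ^ 5 + X 2 ^ 5)) ∉ 𝔫 ^ 3) :=
  ⟨heavy_R3, fun 𝔫 _ hu _ hs => notNear_R3_chart_u 𝔫 hu hs, fun 𝔫 _ ht _ hs => notNear_R3_chart_t 𝔫 ht hs,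
    fun 𝔫 _ hw _ hs => notNear_R3_chart_w 𝔫 hw hs, fun 𝔫 _ hz _ hs => notNear_R3_chart_z 𝔫 hz hs⟩

end MapA

end Summit.ResolutionOfSingularities.ResolutionOfSingularities.Theorems.LightCutClasses
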